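import Literature.MathematicalPhysics.QuantumFieldTheory.Balaban1983to89.B1Eq324BenfattoSect5Cumulant
import Literature.MathematicalPhysics.QuantumFieldTheory.Balaban1983to89.B1Eq324BenfattoKernelAppendixCLemma2
import HarnessLib

/-!
# `Balaban1983to89.B1Eq324BenfattoKernelSect5Cumulant` — [BenfattoEtAl1978] §5 p. 156, displays (5.19), (5.20), (5.22): THE
# SMALL-FIELD VOLUME OF A BOX AND THE CHARACTERISTIC FUNCTION ELIMINATED, FOR A GENERAL SHIFTED GAUSSIAN KERNEL FIELD
# `𝒩(0,K)∘(u + ·)⁻¹` — the per-box inputs of the lower bound (4.7) with the two free-field facts they use DISPLAYED AS ROWS, PROVED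

statement-level skeleton of published theorems with citation tags; proofs where landed; nothing here is a claim about the
Yang–Mills mass gap

WHY THIS MODULE (cell `pub-ymgap`, seat `dag-n08-b` gen 12; node N08 [Balaban1985UV3]; the [BenfattoEtAl1978] source chain behind the
(α)-row `h324c`).  `…B1Eq324BenfattoSect5Cumulant` (this seat, gen 4) proves the two measure-theoretic inequalities of pp. 155–156 for ANY
probability measure (§1–§4 there: (5.16)–(5.18) `integral_exp_mul_rpow_le_integral_mul_exp`, (5.20) `integral_exp_mul_exp_neg_le_setIntegral`,
(5.22) `sum_sub_sub_le_log_integral_mul_exp`) and then, in its §5, reads them ON PRINT'S OBJECT — the conditioned free field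
`P̄(dz_□|z_{Γ₁}) = condField d α β Γ z̄` — with the one free-field input (5.19) *"Finally we use the lemma on the free field (see Appendix C)
∫χ_□^b P̄(dz_□|z_{Γ₁}) ≧ exp(−3b^{2d}e^{−b²/4})"* taken from the tree's App. C Lemma 2 for `freeCov d α β` (`eq519_condField`,
`eq520_condField`, `eq522_condField`; consumer `…Sect5PerBoxOnData.perBox_condField`).  The class road of the Basic Lemma (seats
n08-b/n08-c/n08-d; notes `N08-BASICLEMMA-KERNEL-CENSUS.md`, `N08-PORT-MAP-CLUSTER-SIDE.md` §1–§2, `N08-PORT-MAP-STRUCTURAL-SIDE.md`) re-reads §5 for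
the Gaussian field of a general positive-semidefinite kernel: its per-box measures are the part fields
`N^K_{P,ξ} = (gaussianFieldOfKernel K_P).map (fun ζ x => condMean K Γ ξ x + ζ x)` (`…KernelSect5Eq513`), i.e. SHIFTED KERNEL FIELDS
`μ_{K,u} := (gaussianFieldOfKernel K).map (fun ζ y => u y + ζ y)`, and App. C Lemma 2 is available for exactly these
(`…KernelAppendixCLemma2.appC_lemma2_of_shift`, seat n08-c: one-site variances `K x x ≤ ½` and a centre `|u x| ≤ ½·b(1 + d(I,x))` on the box).
This file is §5 of `…Sect5Cumulant` in that currency: the SAME three statements with `condField d α β Γ z̄ ↦ μ_{K,u}` and the free-field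
hypotheses `E z² ≤ ½`, `γ(1+2d/α²) ≤ ½`, `|z̄_c| ≤ γb(1+d(I,c))` replaced by the two Lemma-2 ROWS they were used to produce (port map §2,
rows R1/R3 in the Lemma-2 form, R5) — so that the kernel edition of the per-box estimate reads (5.19) BY NAME.  The currency is written as
the literal term `(gaussianFieldOfKernel K).map fun (ζ : Site d → ℝ) (y : Site d) => u y + ζ y` (the tree's convention since
`…KernelAppendixD` §1 / `…KernelCondToFree` §1 / `…KernelSect5Eq513`), so that consumers close by `exact`.

THE PRINTED TEXT (p. 156; verbatim from the page image `bcg_p156.png` of the lit-balaban store; ⟦sic⟧ marks print as found): *"Hence"*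
`∫P̄(dz_□|z_{Γ₁})χ_□^b exp Ψ_□χ_□^b ≧ (∫P̄(dz_□|z_{Γ₁}) exp Ψ_□χ_□^b)·(∫P̄(dz_□|z_{Γ₁})χ_□^b)^{exp 2s₂Ab^{D+2d}}` (5.18). *"Finally we use
the lemma on the free field (see Appendix C)"* `∫χ_□^b P̄(dz_□|z_{Γ₁}) ≧ exp(−3b^{2d}e^{−b²/4})` (5.19) *"to derive the bound used in (5.15)"*
`∫P̄(dz_□|z_{Γ₁})χ_□^b exp Ψ_□χ_□^b ≧ [∫P̄(dz_□|z_{Γ₁}) exp Ψ_□χ_□^b]·exp(−3b^{2d}e^{−b²/4}e^{2s₂Ab^{D+2d}})` (5.20). … *"Combining (5.21),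
(5.20) and (5.15)"* `[(5.12)] ≧ … Π_{□∩J≠∅}{exp Σ₁ᵗ_k (1/k!) 𝓔^T_{z_{Γ₁}}(Ψ_□χ_□^b; k)·exp −[(2^{(t+1)²}(t+1)!/(t+1)!)(s₂b^{D+2d}A)^{t+1}
e^{2s₂Ab^{D+2d}} + 3b^{2d}e^{−b²/4}e^{2s₂Ab^{D+2d}}]}` (5.22) ⟦sic: the un-cancelled `(t+1)!/(t+1)!`⟧.  Appendix C p. 165, Lemma 2:
*"P(|z_Δ| < b(1 + d(Δ, I)), ∀Δ ∈ □ | z̄_Γ) ≧ 1 − 2|□|e^{−b²/4}"*.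

DICTIONARY.  `P̄(dz_□|z_{Γ₁})` ↦ `(gaussianFieldOfKernel K).map fun ζ y => u y + ζ y` (`K` positive semidefinite on `Q₀ = Site d`,
centre `u`); row R1 (Lemma-2 form) ↦ `hvar : ∀ x ∈ box, K x x ≤ 1/2`; row R3 (profile form) ↦ `hu : ∀ x ∈ box, |u x| ≤ ½·b·(1 + distToRegion I x)`;
the smallness inside `b > b*` ↦ `hsmall : |□|·e^{−b²/4} ≤ 1/6`; `χ_□^b` ↦ the indicator of `{z | ∀ x ∈ □, |z_x| < b(1 + d(I,x))}` (App. C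
Lemma 2's strict `<` for (5.14)'s `≦`); `Ψ_□χ_□^b` ↦ an exponent `X` with `|X| ≤ K` (print: `K = s₂Ab^{D+2d}`); `𝓔^T(X;k)` ↦
`B10Eq24Cumulant.truncExp X μ k`; `|□|` ↦ `box.card`.  The concrete §5 of `…Sect5Cumulant` is the instance `K := condCov (freeCov d α β) Γ`,
`u := condMean (freeCov d α β) Γ z̄` (`…Sect5SlotMoments.condField_eq_map`, `rfl`), its two rows being `…AppendixC.condCov_self_le` + `E z² ≤ ½`
and `…CondCentre.abs_condMean_freeCov_le'` under `γ(1+2d/α²) ≤ ½`.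

WHAT IS PROVED (theorems only; no definition, no named fact, no `sorry`; axioms standard).
* ★ `eq519_shift` — (5.19) for `μ_{K,u}`: `exp(−3|□|e^{−b²/4}) ≤ μ_{K,u}{z | ∀ x ∈ □, |z_x| < b(1 + d(I,x))}` from rows R1/R3 and the
  smallness (App. C Lemma 2 `appC_lemma2_of_shift` BY NAME + `…Sect5Cumulant.exp_neg_three_mul_le`); `eq519_shift_le` — the same for the
  closed event `|z_x| ≤ b(1 + d(I,x))` (print's (5.14) `≦`), which is how `…Sect5PerBoxOnData` reads it.
* `eq520_shift` — (5.20) for `μ_{K,u}` and ANY exponent `|X| ≤ K` a.e.: `(∫e^X dμ_{K,u})·exp(−3|□|e^{−b²/4}·e^{2K}) ≤ ∫_S e^X dμ_{K,u}`.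
* ★ `eq522_shift` — the logarithm of the last factor of (5.22) for `μ_{K,u}`:
  `Σ_{k=1}^{t} 𝓔^T(χ_S X;k)/k! − 2^{C(t+1,2)}K^{t+1}/(t+1)! − e^{2K}·3|□|e^{−b²/4} ≤ log ∫ χ_S e^{χ_S X} dμ_{K,u}` (`|X| ≤ K` on `S`).

HONEST SCOPE / NOT HERE.  (i) The rows R1/R3 are DISPLAYED, not discharged — at the class's per-box instance `(K_□, u_{Γ₁}(ξ))` they are
`…KernelOfPrecision.condCov_kernel_self_pos_le` / `…ClassAppendixC.inv_submatrix_apply_self_pos_le` (with the class datum `1/γ ≤ ½`) and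
`…KernelOfPrecision.abs_condMean_kernel_le_profile` / `…ClassAppendixC.abs_regression_le_profile` (port map §2), NOT restated here; (ii) constants
as in the concrete module (the kernel remainder `2^{C(t+1,2)}`, print's displayed constant dominating it by `…Sect5Cumulant.apriori_le_printed`);
(iii) one self-located row of an UNCOMMISSIONED port (plan g81 (II), START-LIST v11 §n08): nothing is chained to it here; no generalised Basic
Lemma is stated; nothing of [Balaban1985UV3] (41)/(47)/(5) is asserted; count-neutral for N08; nothing about d = 4, the continuum, OS axioms,
a mass gap or the Clay problem.
-/

open MeasureTheory ProbabilityTheory Finset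
open scoped BigOperators Nat

namespace Literature.MathematicalPhysics.QuantumFieldTheory.Balaban1983to89.B1Eq324BenfattoKernelSect5Cumulant

open _root_.MeasureTheory _root_.ProbabilityTheory
open Literature.MathematicalPhysics.QuantumFieldTheory
open Literature.MathematicalPhysics.QuantumFieldTheory.Balaban1983to89.B10Eq24Cumulant (truncExp)
open Literature.MathematicalPhysics.QuantumFieldTheory.Balaban1983to89.B1Eq324BenfattoLemma
open Literature.MathematicalPhysics.QuantumFieldTheory.Balaban1983to89.B1Eq324BenfattoKernelAppendixCLemma2
  (isProbabilityMeasure_gaussianFieldOfKernel_map_add appC_lemma2_of_shift)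
open Literature.MathematicalPhysics.QuantumFieldTheory.Balaban1983to89.B1Eq324BenfattoSect5Cumulant
  (exp_neg_three_mul_le measurableSet_boxSmallField integral_exp_mul_exp_neg_le_setIntegral sum_sub_sub_le_log_integral_mul_exp)

variable {d : ℕ} {K : B1Eq324BenfattoLemma.Site d → B1Eq324BenfattoLemma.Site d → ℝ}

/-! ## §1  (5.19) for a shifted Gaussian kernel field `μ_{K,u} = 𝒩(0,K)∘(u + ·)⁻¹` -/

/-- **(5.19) FOR A SHIFTED GAUSSIAN KERNEL FIELD** — *"the lemma on the free field (see Appendix C)"* in print's exponential form: for a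
positive-semidefinite kernel `K` on `Q₀` with one-site variances `K x x ≤ ½` on the box (row R1, Lemma-2 form), a centre with
`|u x| ≤ ½·b(1 + d(I,x))` on the box (row R3, profile form), `b > 0` and the smallness `|□|e^{−b²/4} ≤ 1/6` (print: inside `b > b*`):
`exp(−3|□|e^{−b²/4}) ≤ μ_{K,u}{z | ∀ x ∈ □, |z_x| < b(1 + d(I,x))}` — App. C Lemma 2 for the shifted field
(`…KernelAppendixCLemma2.appC_lemma2_of_shift`) and `e^{−3y} ≤ 1 − 2y` (`…Sect5Cumulant.exp_neg_three_mul_le`).  The concrete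
`…Sect5Cumulant.eq519_condField` is the instance `K := condCov (freeCov d α β) Γ`, `u := condMean (freeCov d α β) Γ z̄`.
[cite: BenfattoEtAl1978, (5.19) p.156 and Appendix C Lemma 2 p.165] -/
theorem eq519_shift (hK : IsPosSemidefKernel K) (u : B1Eq324BenfattoLemma.Site d → ℝ) {b : ℝ} (hb : 0 < b)
    (I box : Finset (B1Eq324BenfattoLemma.Site d)) (hvar : ∀ x ∈ box, K x x ≤ 1 / 2)
    (hu : ∀ x ∈ box, |u x| ≤ 1 / 2 * b * (1 + distToRegion I x))
    (hsmall : (box.card : ℝ) * Real.exp (-(b ^ 2 / 4)) ≤ 1 / 6) :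
    Real.exp (-(3 * ((box.card : ℝ) * Real.exp (-(b ^ 2 / 4))))) ≤
      ((gaussianFieldOfKernel K).map fun (ζ : B1Eq324BenfattoLemma.Site d → ℝ) (y : B1Eq324BenfattoLemma.Site d) => u y + ζ y).real
        {z | ∀ x ∈ box, |z x| < b * (1 + distToRegion I x)} := by
  have h := appC_lemma2_of_shift hK u hb I box hvar hu
  refine (exp_neg_three_mul_le (by positivity) hsmall).trans ?_
  linarith

/-- (5.19) for the CLOSED box event `{|z_x| ≤ b(1 + d(I,x)) ∀ x ∈ □}` (print's (5.14) `χ_b^□ = χ(|z_Δ| ≦ b(1 + d(Δ, I)), ∀Δ ∈ □ …)`),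
by monotonicity from `eq519_shift` — the shape in which the per-box estimate (`…Sect5PerBoxOnData.perBox_condField`, step «(5.19): the volume
of the box event») consumes it. [cite: BenfattoEtAl1978, (5.14) p.155 and (5.19) p.156] -/
theorem eq519_shift_le (hK : IsPosSemidefKernel K) (u : B1Eq324BenfattoLemma.Site d → ℝ) {b : ℝ} (hb : 0 < b)
    (I box : Finset (B1Eq324BenfattoLemma.Site d)) (hvar : ∀ x ∈ box, K x x ≤ 1 / 2)
    (hu : ∀ x ∈ box, |u x| ≤ 1 / 2 * b * (1 + distToRegion I x))
    (hsmall : (box.card : ℝ) * Real.exp (-(b ^ 2 / 4)) ≤ 1 / 6) :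
    Real.exp (-(3 * ((box.card : ℝ) * Real.exp (-(b ^ 2 / 4))))) ≤
      ((gaussianFieldOfKernel K).map fun (ζ : B1Eq324BenfattoLemma.Site d → ℝ) (y : B1Eq324BenfattoLemma.Site d) => u y + ζ y).real
        {z | ∀ x ∈ box, |z x| ≤ b * (1 + distToRegion I x)} := by
  haveI := isProbabilityMeasure_gaussianFieldOfKernel_map_add hK u
  refine (eq519_shift hK u hb I box hvar hu hsmall).trans (measureReal_mono (fun z hz x hx => (hz x hx).le) ?_)
  exact measure_ne_top _ _

/-! ## §2  (5.20) and (5.22) for `μ_{K,u}` -/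

/-- **(5.20) FOR A SHIFTED GAUSSIAN KERNEL FIELD**: under the rows of `eq519_shift`, for the box small-field event
`S = {|z_x| < b(1 + d(I,x)) ∀ x ∈ □}` and ANY exponent `X` with `|X| ≤ K` `μ_{K,u}`-a.e. (print: `X = Ψ_□χ_□^b`, `K = s₂Ab^{D+2d}`):
`(∫ e^X dμ_{K,u})·exp(−3|□|e^{−b²/4}·e^{2K}) ≤ ∫_S e^X dμ_{K,u}` — print's (5.20) `∫P̄ χ exp Ψχ ≧ [∫P̄ exp Ψχ]·exp(−3b^{2d}e^{−b²/4}e^{2s₂Ab^{D+2d}})`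
(`…Sect5Cumulant.integral_exp_mul_exp_neg_le_setIntegral` with the volume input `eq519_shift`).  The concrete `…Sect5Cumulant.eq520_condField`
is the free-field instance. [cite: BenfattoEtAl1978, (5.20) p.156] -/
theorem eq520_shift (hK : IsPosSemidefKernel K) (u : B1Eq324BenfattoLemma.Site d → ℝ) {b : ℝ} (hb : 0 < b)
    (I box : Finset (B1Eq324BenfattoLemma.Site d)) (hvar : ∀ x ∈ box, K x x ≤ 1 / 2)
    (hu : ∀ x ∈ box, |u x| ≤ 1 / 2 * b * (1 + distToRegion I x))
    (hsmall : (box.card : ℝ) * Real.exp (-(b ^ 2 / 4)) ≤ 1 / 6)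
    {X : (B1Eq324BenfattoLemma.Site d → ℝ) → ℝ} {K' : ℝ}
    (hXm : AEMeasurable X
      ((gaussianFieldOfKernel K).map fun (ζ : B1Eq324BenfattoLemma.Site d → ℝ) (y : B1Eq324BenfattoLemma.Site d) => u y + ζ y))
    (hXK : ∀ᵐ z ∂((gaussianFieldOfKernel K).map
      fun (ζ : B1Eq324BenfattoLemma.Site d → ℝ) (y : B1Eq324BenfattoLemma.Site d) => u y + ζ y), |X z| ≤ K') :
    (∫ z, Real.exp (X z)
        ∂((gaussianFieldOfKernel K).map fun (ζ : B1Eq324BenfattoLemma.Site d → ℝ) (y : B1Eq324BenfattoLemma.Site d) => u y + ζ y)) *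
        Real.exp (-(3 * ((box.card : ℝ) * Real.exp (-(b ^ 2 / 4))) * Real.exp (2 * K'))) ≤
      ∫ z in {z | ∀ x ∈ box, |z x| < b * (1 + distToRegion I x)}, Real.exp (X z)
        ∂((gaussianFieldOfKernel K).map fun (ζ : B1Eq324BenfattoLemma.Site d → ℝ) (y : B1Eq324BenfattoLemma.Site d) => u y + ζ y) := by
  haveI := isProbabilityMeasure_gaussianFieldOfKernel_map_add hK u
  exact integral_exp_mul_exp_neg_le_setIntegral (measurableSet_boxSmallField b I box) hXm hXK
    (eq519_shift hK u hb I box hvar hu hsmall)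

/-- **(5.22)'s LAST FACTOR FOR A SHIFTED GAUSSIAN KERNEL FIELD, in log form**: with `S`, `μ_{K,u}` and the rows as in `eq520_shift` and an
exponent `X` with `|X| ≤ K` ON `S` (`K ≥ 0`),
`Σ_{k=1}^{t} 𝓔^T(χ_S X;k)/k! − 2^{C(t+1,2)}K^{t+1}/(t+1)! − e^{2K}·3|□|e^{−b²/4} ≤ log ∫ χ_S e^{χ_S X} dμ_{K,u}` — print's
`∫P̄(dz_□|z_{Γ₁}) e^{Ψ_□χ_□^b}χ_□^b ≥ exp[Σ_k 𝓔^T_{z_{Γ₁}}(Ψ_□χ_□^b;k)/k! − (remainder) − 3b^{2d}e^{−b²/4}e^{2s₂Ab^{D+2d}}]` (the exponent `χ_S·X` is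
print's `Ψ_□χ_□^b`) (`…Sect5Cumulant.sum_sub_sub_le_log_integral_mul_exp` with the volume input `eq519_shift`).  The concrete
`…Sect5Cumulant.eq522_condField` is the free-field instance. [cite: BenfattoEtAl1978, (5.22) p.156] -/
theorem eq522_shift (hK : IsPosSemidefKernel K) (u : B1Eq324BenfattoLemma.Site d → ℝ) {b : ℝ} (hb : 0 < b)
    (I box : Finset (B1Eq324BenfattoLemma.Site d)) (hvar : ∀ x ∈ box, K x x ≤ 1 / 2)
    (hu : ∀ x ∈ box, |u x| ≤ 1 / 2 * b * (1 + distToRegion I x))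
    (hsmall : (box.card : ℝ) * Real.exp (-(b ^ 2 / 4)) ≤ 1 / 6)
    {X : (B1Eq324BenfattoLemma.Site d → ℝ) → ℝ} {K' : ℝ}
    (hXm : AEMeasurable X
      ((gaussianFieldOfKernel K).map fun (ζ : B1Eq324BenfattoLemma.Site d → ℝ) (y : B1Eq324BenfattoLemma.Site d) => u y + ζ y))
    (hXK : ∀ z ∈ {z | ∀ x ∈ box, |z x| < b * (1 + distToRegion I x)}, |X z| ≤ K') (hK' : 0 ≤ K') (t : ℕ) :
    let S : Set (B1Eq324BenfattoLemma.Site d → ℝ) := {z | ∀ x ∈ box, |z x| < b * (1 + distToRegion I x)}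
    let P := (gaussianFieldOfKernel K).map fun (ζ : B1Eq324BenfattoLemma.Site d → ℝ) (y : B1Eq324BenfattoLemma.Site d) => u y + ζ y
    (∑ k ∈ Finset.range t, truncExp (fun z => S.indicator 1 z * X z) P (k + 1) / (k + 1)!)
        - 2 ^ ((t + 1).choose 2) * K' ^ (t + 1) / (t + 1)!
        - Real.exp (2 * K') * (3 * ((box.card : ℝ) * Real.exp (-(b ^ 2 / 4)))) ≤
      Real.log (∫ z, S.indicator 1 z * Real.exp (S.indicator 1 z * X z) ∂P) := by
  intro S P
  haveI : IsProbabilityMeasure P := isProbabilityMeasure_gaussianFieldOfKernel_map_add hK u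
  have hS : MeasurableSet S := measurableSet_boxSmallField b I box
  have hχm : Measurable (S.indicator (1 : (B1Eq324BenfattoLemma.Site d → ℝ) → ℝ)) := measurable_one.indicator hS
  have hχ0 : ∀ z, 0 ≤ S.indicator (1 : (B1Eq324BenfattoLemma.Site d → ℝ) → ℝ) z :=
    fun z => Set.indicator_nonneg (fun _ _ => zero_le_one) z
  have hχ1 : ∀ z, S.indicator (1 : (B1Eq324BenfattoLemma.Site d → ℝ) → ℝ) z ≤ 1 :=
    fun z => Set.indicator_le_self' (fun _ _ => zero_le_one) z
  have hYm : AEMeasurable (fun z => S.indicator 1 z * X z) P := (hχm.aemeasurable).mul hXm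
  have hYK : ∀ᵐ z ∂P, |S.indicator (1 : (B1Eq324BenfattoLemma.Site d → ℝ) → ℝ) z * X z| ≤ K' := by
    refine ae_of_all _ fun z => ?_
    by_cases hz : z ∈ S
    · rw [Set.indicator_of_mem hz, Pi.one_apply, one_mul]
      exact hXK z hz
    · rw [Set.indicator_of_notMem hz, zero_mul, abs_zero]
      exact hK'
  have hW : Real.exp (-(3 * ((box.card : ℝ) * Real.exp (-(b ^ 2 / 4))))) ≤ ∫ z, S.indicator 1 z ∂P := by
    rw [integral_indicator_one hS]
    exact eq519_shift hK u hb I box hvar hu hsmall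
  exact sum_sub_sub_le_log_integral_mul_exp hχm hχ0 hχ1 hYm hYK hW t

end Literature.MathematicalPhysics.QuantumFieldTheory.Balaban1983to89.B1Eq324BenfattoKernelSect5Cumulant
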